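import Summits.AtomisticToContinuum.Crystallization.Theses.SquareWellLayerCake
import Summits.AtomisticToContinuum.Crystallization.Theorems.AveragedTwelve.Negative.LoadBearing
import Summits.AtomisticToContinuum.Crystallization.Theorems.AveragedTwelve.Negative.RatioTightBcc
import Summits.AtomisticToContinuum.Crystallization.Theorems.AveragedTwelve.Negative.StarLocal
import Summits.AtomisticToContinuum.Crystallization.Theorems.AveragedTwelve.Negative.PointwiseSixteen
import Summits.AtomisticToContinuum.Crystallization.Theorems.AveragedTwelve.Negative.BallTwo

/-!
# Disproof of `AveragedTwelve` (crux stmt-AtomisticToContinuum-15806) — findings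

Work file of the crux disprover (cdisprove gen 1 cycle 1 + gen 2 cycle 1).  Prose lives in docstrings only.
Gen-2 refutations are LANDED under `Theorems/AveragedTwelve/Negative/{StarLocal,PointwiseSixteen,BallTwo}.lean` (p142464,
p142829, p143287) and imported here; §7–§9 restate them against the named local forms by one-line proofs.

INDEX
* §0  `AveragedTwelveAt c` — the crux with the ratio constant `57/50` replaced by a parameter `c`;
      `averagedTwelve_iff_at : AveragedTwelve ↔ AveragedTwelveAt (57/50)`, monotonicity in `c`.
* §1  LOAD-BEARING HYPOTHESES (each dropped in turn ⇒ false, explicit witnesses):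
      `averagedTwelve_false_without_pos`   (drop `0 < d`: 14 coincident points, d = ρ = 0),
      `averagedTwelve_false_without_sep`   (drop the separation hypothesis: 14 coincident points),
      `averagedTwelve_false_without_ratio` (drop `ρ ≤ 57/50·d`: 14 collinear points, ρ = 13).
* §2  INTEGER-COORDINATE REDUCTION `not_averagedTwelveAt_of_intConfig`: a finite configuration with
      integer coordinates, squared separation `D`, integer radius `M ≤ c·√D` and more than `12 N`
      ordered close pairs refutes `AveragedTwelveAt c` — the shape in which any counterexample found
      by the search would be landed (and the shape of §3, §4).
* §3  TIGHTNESS of the constant: `averagedTwelveAt_false_of_le` — for every `c ≥ 2/√3 ≈ 1.1547` the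
      statement fails: the bcc ball `{p ∈ ℤ³ : p₀ ≡ p₁ ≡ p₂ (mod 2), |p|² ≤ 91}` (941 points,
      `d = √3`, `ρ = 2`) has 11336 > 12·941 = 11292 ordered pairs at distance ≤ 2
      (`native_decide`, computational).  So any proof must use `57/50 < 2/√3` (margin 1.3 %).
* §4  NATURAL STRENGTHENING REFUTED: the POINTWISE bound (≤ 12 ρ-neighbours per centre) is false at
      ratio 57/50: `not_averagedTwelvePointwise` (a centre with 14 neighbours, integer coordinates,
      D = 389, M = 22; up to 16 fit by Tammes).  Any proof must genuinely average over centres.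
* §5  SEARCH RECORD / WHY IT RESISTS (docstring `search_record`): no configuration with average
      > 12 at any ratio < 2/√3 is known; equality locus is large and floppy.
* §6  (gen 2) LATTICE CASE IS TRUE (docstring theorem `lattice_case_record`): no Bravais lattice has more than
      12 vectors of length in `[λ₁, c·λ₁]` for any `c < 2/√3`; bcc is the unique lattice reaching 14 at `2/√3`
      (vonorm / obtuse-superbase argument, written out; not formalised).  A counterexample is necessarily non-lattice.
* §7  (gen 2) RADIUS-ONE LOCAL FORM REFUTED: `AveragedTwelveStar` (every closed ρ-star averages ≤ 12) IMPLIES the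
      crux (`averagedTwelve_of_star`, Cauchy–Schwarz) and is FALSE at 57/50 (`not_averagedTwelveStar`: a Z14 centre
      whose 14 neighbours all have ≥ 12, closed star 15 sites summing to 185 > 180; integer certificate, kit j022691).
      COROLLARY: the route's planned layer-2 child "CompensationLemma" (every Z ≥ 13 site is compensated by
      Σ(12 − Z)₊ among its own 1.14-neighbours) is FALSE — do not file it; any discharging must reach beyond radius 1.
* §8  (gen 2) POINTWISE EXCESS +4 OCCURS: a centre with 16 neighbours at ratio ≤ 57/50 (`not_averagedTwelvePointwise15`,
      Tammes-16 radius 1.1358 < 1.14; 17 would need the unproved Tammes-17 value 1.1589).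
* §9  (gen 2) RADIUS-TWO BALL AVERAGING REFUTED (`not_averagedTwelveBall2`, 151-point certificate, computational) but
      radius three NOT reached; SEARCH RECORD II (`search_record_g2`): periodic Z14 rods cannot keep their rings at 12,
      rod crystals, tolerance-tempering Monte Carlo, literature; WHY IT STILL RESISTS (radius ≥ 3 or structural).
-/

namespace Summit.AtomisticToContinuum.Crystallization.Cruxes.AveragedTwelve.Disproof

open Summit.AtomisticToContinuum.Crystallization.Theses.SquareWellLayerCake
open scoped BigOperators

/-! ## §0 The parametrised statement -/

/-- `AveragedTwelve` with the ratio constant `57/50` replaced by `c`. -/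
def AveragedTwelveAt (c : ℝ) : Prop :=
  ∀ (N : ℕ) (x : Fin N → EuclideanSpace ℝ (Fin 3)) (G : Finset (Fin N)) (d ρ : ℝ), 0 < d → ρ ≤ c * d →
    (∀ i ∈ G, ∀ j ∈ G, i ≠ j → d ≤ dist (x i) (x j)) →
    (∑ i ∈ G, ((G.filter fun j => j ≠ i ∧ dist (x i) (x j) ≤ ρ).card : ℝ)) ≤ 12 * G.card

theorem averagedTwelve_iff_at : AveragedTwelve ↔ AveragedTwelveAt (57 / 50) := Iff.rfl

/-- Monotonicity in the constant: a larger admissible ratio is a stronger statement. -/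
theorem averagedTwelveAt_mono {c c' : ℝ} (h : c ≤ c') : AveragedTwelveAt c' → AveragedTwelveAt c := by
  intro H N x G d ρ hd hρ hsep
  exact H N x G d ρ hd (hρ.trans (mul_le_mul_of_nonneg_right h hd.le)) hsep

/-! ## §1 Load-bearing hypotheses -/

/-- The crux with `0 < d` dropped. -/
def AveragedTwelveWithoutPos : Prop :=
  ∀ (N : ℕ) (x : Fin N → EuclideanSpace ℝ (Fin 3)) (G : Finset (Fin N)) (d ρ : ℝ), ρ ≤ 57 / 50 * d →
    (∀ i ∈ G, ∀ j ∈ G, i ≠ j → d ≤ dist (x i) (x j)) →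
    (∑ i ∈ G, ((G.filter fun j => j ≠ i ∧ dist (x i) (x j) ≤ ρ).card : ℝ)) ≤ 12 * G.card

/-- The crux with the separation hypothesis dropped. -/
def AveragedTwelveWithoutSep : Prop :=
  ∀ (N : ℕ) (x : Fin N → EuclideanSpace ℝ (Fin 3)) (G : Finset (Fin N)) (d ρ : ℝ), 0 < d → ρ ≤ 57 / 50 * d →
    (∑ i ∈ G, ((G.filter fun j => j ≠ i ∧ dist (x i) (x j) ≤ ρ).card : ℝ)) ≤ 12 * G.card

/-- The crux with the ratio bound `ρ ≤ 57/50·d` dropped. -/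
def AveragedTwelveWithoutRatio : Prop :=
  ∀ (N : ℕ) (x : Fin N → EuclideanSpace ℝ (Fin 3)) (G : Finset (Fin N)) (d ρ : ℝ), 0 < d →
    (∀ i ∈ G, ∀ j ∈ G, i ≠ j → d ≤ dist (x i) (x j)) →
    (∑ i ∈ G, ((G.filter fun j => j ≠ i ∧ dist (x i) (x j) ≤ ρ).card : ℝ)) ≤ 12 * G.card

/-- `N` coincident points at the origin. -/
def coincident (N : ℕ) : Fin N → EuclideanSpace ℝ (Fin 3) := fun _ => 0

/-- With all `N` points coincident every point has `N - 1` neighbours at distance `0 ≤ ρ`. -/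
lemma sum_card_coincident (N : ℕ) (ρ : ℝ) (hρ : 0 ≤ ρ) :
    (∑ i ∈ (Finset.univ : Finset (Fin N)),
      (((Finset.univ : Finset (Fin N)).filter fun j => j ≠ i ∧
        dist (coincident N i) (coincident N j) ≤ ρ).card : ℝ)) = N * ((N - 1 : ℕ) : ℝ) := by
  have h : ∀ i : Fin N, ((Finset.univ : Finset (Fin N)).filter fun j => j ≠ i ∧
        dist (coincident N i) (coincident N j) ≤ ρ) = Finset.univ.erase i := by
    intro i
    ext j
    simp [coincident, hρ, Finset.mem_erase]
  simp_rw [h, Finset.card_erase_of_mem (Finset.mem_univ _), Finset.card_univ, Fintype.card_fin]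
  simp [Finset.sum_const, Finset.card_univ, Fintype.card_fin]

/-- Any proof must use `0 < d`: with `d = ρ = 0`, fourteen coincident points have 13 > 12
neighbours each. -/
theorem averagedTwelve_false_without_pos : ¬ AveragedTwelveWithoutPos := by
  intro H
  have h := H 14 (coincident 14) Finset.univ 0 0 (by norm_num) (by intro i _ j _ _; exact dist_nonneg)
  rw [sum_card_coincident 14 0 le_rfl] at h
  simp at h
  norm_num at h

/-- Any proof must use the separation hypothesis: fourteen coincident points, `d = 1`, `ρ = 57/50`. -/
theorem averagedTwelve_false_without_sep : ¬ AveragedTwelveWithoutSep := by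
  intro H
  have h := H 14 (coincident 14) Finset.univ 1 (57 / 50) (by norm_num) (by norm_num)
  rw [sum_card_coincident 14 (57 / 50) (by norm_num)] at h
  simp at h
  norm_num at h

/-- Fourteen collinear points at unit spacing. -/
noncomputable def collinear14 : Fin 14 → EuclideanSpace ℝ (Fin 3) := fun i => !₂[((i : ℕ) : ℝ), 0, 0]

lemma dist_collinear14 (i j : Fin 14) :
    dist (collinear14 i) (collinear14 j) = |((i : ℕ) : ℝ) - ((j : ℕ) : ℝ)| := by
  rw [EuclideanSpace.dist_eq, Fin.sum_univ_three]
  simp [collinear14, Real.dist_eq, sq_abs, Real.sqrt_sq_eq_abs]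

/-- Any proof must use the ratio bound: fourteen collinear points at unit spacing, `d = 1`, `ρ = 13`. -/
theorem averagedTwelve_false_without_ratio : ¬ AveragedTwelveWithoutRatio := by
  intro H
  have hsep : ∀ i ∈ (Finset.univ : Finset (Fin 14)), ∀ j ∈ (Finset.univ : Finset (Fin 14)), i ≠ j →
      (1 : ℝ) ≤ dist (collinear14 i) (collinear14 j) := by
    intro i _ j _ hij
    rw [dist_collinear14]
    have hne : (i : ℕ) ≠ (j : ℕ) := Fin.val_ne_of_ne hij
    rcases Nat.lt_or_gt_of_ne hne with hlt | hlt
    · have : ((i : ℕ) : ℝ) + 1 ≤ ((j : ℕ) : ℝ) := by exact_mod_cast hlt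
      rw [abs_sub_comm]
      exact le_abs.mpr (Or.inl (by linarith))
    · have : ((j : ℕ) : ℝ) + 1 ≤ ((i : ℕ) : ℝ) := by exact_mod_cast hlt
      exact le_abs.mpr (Or.inl (by linarith))
  have h := H 14 collinear14 Finset.univ 1 13 (by norm_num) hsep
  have hfilt : ∀ i : Fin 14, ((Finset.univ : Finset (Fin 14)).filter fun j => j ≠ i ∧
        dist (collinear14 i) (collinear14 j) ≤ 13) = Finset.univ.erase i := by
    intro i
    ext j
    simp only [Finset.mem_filter, Finset.mem_univ, true_and, Finset.mem_erase, and_true]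
    constructor
    · exact fun hx => hx.1
    · intro hji
      refine ⟨hji, ?_⟩
      rw [dist_collinear14]
      have hi : ((i : ℕ) : ℝ) ≤ 13 := by exact_mod_cast Nat.lt_succ_iff.mp i.isLt
      have hj : ((j : ℕ) : ℝ) ≤ 13 := by exact_mod_cast Nat.lt_succ_iff.mp j.isLt
      have hi0 : (0 : ℝ) ≤ ((i : ℕ) : ℝ) := by positivity
      have hj0 : (0 : ℝ) ≤ ((j : ℕ) : ℝ) := by positivity
      exact abs_sub_le_iff.mpr ⟨by linarith, by linarith⟩
  simp_rw [hfilt, Finset.card_erase_of_mem (Finset.mem_univ _), Finset.card_univ, Fintype.card_fin] at h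
  simp at h
  norm_num at h

/-! ## §2 Integer-coordinate reduction -/

/-- Squared Euclidean distance of integer triples. -/
def sqdZ (p q : Fin 3 → ℤ) : ℤ := (p 0 - q 0) ^ 2 + (p 1 - q 1) ^ 2 + (p 2 - q 2) ^ 2

lemma sqdZ_nonneg (p q : Fin 3 → ℤ) : 0 ≤ sqdZ p q := by unfold sqdZ; positivity

/-- An integer configuration as points of Euclidean 3-space. -/
noncomputable def cfg {N : ℕ} (pts : Fin N → Fin 3 → ℤ) : Fin N → EuclideanSpace ℝ (Fin 3) :=
  fun i => !₂[((pts i 0 : ℤ) : ℝ), ((pts i 1 : ℤ) : ℝ), ((pts i 2 : ℤ) : ℝ)]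

lemma dist_cfg {N : ℕ} (pts : Fin N → Fin 3 → ℤ) (i j : Fin N) :
    dist (cfg pts i) (cfg pts j) = Real.sqrt ((sqdZ (pts i) (pts j) : ℤ) : ℝ) := by
  rw [EuclideanSpace.dist_eq, Fin.sum_univ_three]
  simp only [cfg, sqdZ, Real.dist_eq, sq_abs]
  push_cast
  congr 1

lemma sqrt_le_dist_cfg_iff {N : ℕ} (pts : Fin N → Fin 3 → ℤ) (D : ℤ) (i j : Fin N) :
    Real.sqrt D ≤ dist (cfg pts i) (cfg pts j) ↔ D ≤ sqdZ (pts i) (pts j) := by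
  rw [dist_cfg, Real.sqrt_le_sqrt_iff (by exact_mod_cast sqdZ_nonneg _ _)]
  exact_mod_cast Iff.rfl

lemma dist_cfg_le_iff {N : ℕ} (pts : Fin N → Fin 3 → ℤ) (M : ℤ) (hM : 0 ≤ M) (i j : Fin N) :
    dist (cfg pts i) (cfg pts j) ≤ M ↔ sqdZ (pts i) (pts j) ≤ M ^ 2 := by
  rw [dist_cfg, Real.sqrt_le_left (by exact_mod_cast hM)]
  exact_mod_cast Iff.rfl

/-- INTEGER REDUCTION.  A configuration with integer coordinates, pairwise squared distances `≥ D`,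
an integer radius `M` with `M ≤ c·√D`, and more than `12 N` ordered pairs at squared distance `≤ M²`
refutes `AveragedTwelveAt c`.  All hypotheses except `hcM` are decidable integer facts. -/
theorem not_averagedTwelveAt_of_intConfig (c : ℝ) {N : ℕ} (pts : Fin N → Fin 3 → ℤ) (D M : ℤ)
    (hD : 0 < D) (hM : 0 ≤ M) (hcM : (M : ℝ) ≤ c * Real.sqrt D)
    (hsep : ∀ i j : Fin N, i ≠ j → D ≤ sqdZ (pts i) (pts j))
    (hcount : 12 * N < ∑ i : Fin N,
      ((Finset.univ.filter fun j : Fin N => j ≠ i ∧ sqdZ (pts i) (pts j) ≤ M ^ 2).card)) :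
    ¬ AveragedTwelveAt c := by
  intro H
  have hsep' : ∀ i ∈ (Finset.univ : Finset (Fin N)), ∀ j ∈ (Finset.univ : Finset (Fin N)), i ≠ j →
      Real.sqrt D ≤ dist (cfg pts i) (cfg pts j) :=
    fun i _ j _ hij => (sqrt_le_dist_cfg_iff pts D i j).mpr (hsep i j hij)
  have h := H N (cfg pts) Finset.univ (Real.sqrt D) M (Real.sqrt_pos.mpr (by exact_mod_cast hD)) hcM hsep'
  have hfilt : ∀ i : Fin N, ((Finset.univ : Finset (Fin N)).filter fun j : Fin N => j ≠ i ∧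
        dist (cfg pts i) (cfg pts j) ≤ (M : ℝ))
      = (Finset.univ.filter fun j : Fin N => j ≠ i ∧ sqdZ (pts i) (pts j) ≤ M ^ 2) := by
    intro i
    apply Finset.filter_congr
    intro j _
    rw [dist_cfg_le_iff pts M hM]
  simp_rw [hfilt, Finset.card_univ, Fintype.card_fin] at h
  have hc : ((12 * N : ℕ) : ℝ) <
      ((∑ i : Fin N, ((Finset.univ.filter fun j : Fin N => j ≠ i ∧ sqdZ (pts i) (pts j) ≤ M ^ 2).card) : ℕ) : ℝ) := by
    exact_mod_cast hcount
  push_cast at hc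
  linarith

/-! ## §3 Tightness of the constant: bcc at ratio `2/√3` -/

/-- The bcc ball: integer triples of uniform parity (the body-centred cubic lattice `2ℤ³ ∪ (2ℤ³+𝟙)`,
nearest-neighbour distance² 3, second distance² 4, ratio `2/√3`) inside `|p|² ≤ 91`; 941 points. -/
def bccBall : List (Fin 3 → ℤ) :=
  (List.range 19).flatMap fun a => (List.range 19).flatMap fun b => (List.range 19).filterMap fun c =>
    let x : ℤ := (a : ℤ) - 9
    let y : ℤ := (b : ℤ) - 9
    let z : ℤ := (c : ℤ) - 9
    if x % 2 = y % 2 ∧ y % 2 = z % 2 ∧ x ^ 2 + y ^ 2 + z ^ 2 ≤ 91 then some ![x, y, z] else none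

/-- The bcc ball as an indexed configuration. -/
def bccPts : Fin bccBall.length → Fin 3 → ℤ := fun i => bccBall[i]

theorem bccBall_length : bccBall.length = 941 := by native_decide

theorem bccPts_sep : ∀ i j : Fin bccBall.length, i ≠ j → 3 ≤ sqdZ (bccPts i) (bccPts j) := by
  native_decide

/-- 11336 ordered pairs at squared distance ≤ 4 (8 nearest + 6 second neighbours in the bulk),
against `12 · 941 = 11292`. -/
theorem bccPts_count : 12 * bccBall.length < ∑ i : Fin bccBall.length,
    ((Finset.univ.filter fun j : Fin bccBall.length => j ≠ i ∧ sqdZ (bccPts i) (bccPts j) ≤ 2 ^ 2).card) := by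
  native_decide

/-- TIGHTNESS (computational: `native_decide`).  `AveragedTwelveAt c` is FALSE for every
`c ≥ 2/√3 ≈ 1.1547`: a 941-point ball of the bcc lattice (d = √3, ρ = 2) averages
11336/941 ≈ 12.047 > 12 ordered ρ-close pairs per point (14 in the bulk).  Hence the crux's constant
57/50 = 1.14 sits 1.3 % below a ratio where the statement fails, and no proof can be insensitive to
the constant at that scale. -/
theorem averagedTwelveAt_false_of_le (c : ℝ) (hc : 2 / Real.sqrt 3 ≤ c) : ¬ AveragedTwelveAt c := by
  have h3 : (0 : ℝ) < Real.sqrt 3 := Real.sqrt_pos.mpr (by norm_num)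
  have hcM : ((2 : ℤ) : ℝ) ≤ c * Real.sqrt ((3 : ℤ) : ℝ) := by
    have : (2 : ℝ) ≤ c * Real.sqrt 3 := (div_le_iff₀ h3).mp hc
    exact_mod_cast this
  exact not_averagedTwelveAt_of_intConfig c bccPts 3 2 (by norm_num) (by norm_num) hcM bccPts_sep bccPts_count

/-- In particular the statement is false at the bcc ratio itself. -/
theorem averagedTwelveAt_bcc_false : ¬ AveragedTwelveAt (2 / Real.sqrt 3) :=
  averagedTwelveAt_false_of_le _ le_rfl

/-! ## §4 The pointwise strengthening is false at ratio 57/50 -/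

/-- POINTWISE form of the crux: every centre has at most 12 ρ-neighbours.  FALSE (see below);
recorded because every one-centre proof strategy proves this stronger statement. -/
def AveragedTwelvePointwise : Prop :=
  ∀ (N : ℕ) (x : Fin N → EuclideanSpace ℝ (Fin 3)) (G : Finset (Fin N)) (d ρ : ℝ), 0 < d → ρ ≤ 57 / 50 * d →
    (∀ i ∈ G, ∀ j ∈ G, i ≠ j → d ≤ dist (x i) (x j)) →
    ∀ i ∈ G, ((G.filter fun j => j ≠ i ∧ dist (x i) (x j) ≤ ρ).card) ≤ 12

/-- The pointwise form implies the averaged crux (so it IS a strengthening). -/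
theorem averagedTwelve_of_pointwise : AveragedTwelvePointwise → AveragedTwelve := by
  intro H N x G d ρ hd hρ hsep
  have hle : ∀ i ∈ G, (((G.filter fun j => j ≠ i ∧ dist (x i) (x j) ≤ ρ).card : ℕ) : ℝ) ≤ 12 := by
    intro i hi
    exact_mod_cast H N x G d ρ hd hρ hsep i hi
  calc (∑ i ∈ G, ((G.filter fun j => j ≠ i ∧ dist (x i) (x j) ≤ ρ).card : ℝ))
      ≤ ∑ i ∈ G, (12 : ℝ) := Finset.sum_le_sum hle
    _ = 12 * G.card := by rw [Finset.sum_const, nsmul_eq_mul, mul_comm]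

/-- A centre (index 0) with FOURTEEN neighbours: bicapped staggered hexagonal arrangement, integer
coordinates (scale 20, radius ≈ 1.1·d); min squared distance 389, all 14 satellites within
squared distance 484 = 22² ≤ (57/50)²·389. -/
def witness15 : Fin 15 → Fin 3 → ℤ :=
  ![![0, 0, 0], ![0, 0, 22], ![0, 0, -22], ![20, 0, 9], ![10, 17, 9], ![-10, 17, 9], ![-20, 0, 9],
    ![-10, -17, 9], ![10, -17, 9], ![17, 10, -9], ![0, 20, -9], ![-17, 10, -9], ![-17, -10, -9],
    ![0, -20, -9], ![17, -10, -9]]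

theorem witness15_sep : ∀ i j : Fin 15, i ≠ j → 389 ≤ sqdZ (witness15 i) (witness15 j) := by decide

theorem witness15_count :
    ((Finset.univ.filter fun j : Fin 15 => j ≠ 0 ∧ sqdZ (witness15 0) (witness15 j) ≤ 22 ^ 2).card) = 14 := by
  decide

/-- The POINTWISE strengthening of the crux is false at ratio 57/50 (14 > 12 neighbours of one centre;
Tammes radii: 13/14/15/16 neighbours fit from ratios 1.0456/1.0709/1.108/1.1356).  Any proof of
`AveragedTwelve` must average over centres. -/
theorem not_averagedTwelvePointwise : ¬ AveragedTwelvePointwise := by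
  intro H
  have hsq : (0 : ℝ) < Real.sqrt 389 := Real.sqrt_pos.mpr (by norm_num)
  have hcM : ((22 : ℤ) : ℝ) ≤ 57 / 50 * Real.sqrt ((389 : ℤ) : ℝ) := by
    have h1 : (1100 / 57 : ℝ) ≤ Real.sqrt 389 := (Real.le_sqrt' (by norm_num)).mpr (by norm_num)
    push_cast
    linarith
  have hsep' : ∀ i ∈ (Finset.univ : Finset (Fin 15)), ∀ j ∈ (Finset.univ : Finset (Fin 15)), i ≠ j →
      Real.sqrt ((389 : ℤ) : ℝ) ≤ dist (cfg witness15 i) (cfg witness15 j) :=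
    fun i _ j _ hij => (sqrt_le_dist_cfg_iff witness15 389 i j).mpr (witness15_sep i j hij)
  have h := H 15 (cfg witness15) Finset.univ (Real.sqrt ((389 : ℤ) : ℝ)) ((22 : ℤ) : ℝ)
    (Real.sqrt_pos.mpr (by norm_num)) hcM hsep' 0 (Finset.mem_univ _)
  have hfilt : ((Finset.univ : Finset (Fin 15)).filter fun j : Fin 15 => j ≠ 0 ∧
        dist (cfg witness15 0) (cfg witness15 j) ≤ ((22 : ℤ) : ℝ))
      = (Finset.univ.filter fun j : Fin 15 => j ≠ 0 ∧ sqdZ (witness15 0) (witness15 j) ≤ 22 ^ 2) := by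
    apply Finset.filter_congr
    intro j _
    rw [dist_cfg_le_iff witness15 22 (by norm_num)]
  rw [hfilt, witness15_count] at h
  omega


/-! ## §5 Search record — why 12 resists below 2/√3 (no theorem; documentation for provers)

See the docstring of `search_record`. -/

/-- SEARCH RECORD AND STRUCTURE THEORY (cdisprove cycle 1, 2026-08-16; extends the route-review refuter's
kit j019115 and the planner's j018653).  Target: a d-separated finite/periodic set in ℝ³ averaging > 12 other
points within t·d for some t ≤ 57/50.

LANDED (gate-accepted, importable by provers/ideators):
* `Theorems/AveragedTwelve/Negative/LoadBearing.lean` (p129096): `averagedTwelve_false_without_pos/sep/ratio`,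
  `not_averagedTwelveAt_of_intConfig` (refutation shape), `not_averagedTwelve_pointwise`, `averaged_of_pointwise`.
* `Theorems/AveragedTwelve/Negative/RatioTightBcc.lean` (p129467, computational): `averagedTwelve_false_at_ratio_ge_bcc`
  (¬A(c) for all c ≥ 2/√3), `averagedTwelve_false_at_bcc_ratio`, `ratio_lt_bcc_of_averagedTwelveAt`.

EXACT LANDSCAPE of reference structures (average number of other points within t·d; kit j020382 part A):
fcc/hcp 12 for t < √2 (18 at √2); bcc 8 for t < 2/√3, 14 from 2/√3; sc 6; ω = AlB₂ single-species (14,11,11) = 12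
exactly from t = √5/2 = 1.118; bct(c/a = 1.1) 12; β-Mn 12.000 at 1.14 (3.6 at 1.10); A15 7.5; σ 7.07; C14 4; C15 4;
Zr₄Al₃ 5.7; α-Mn 3.7 — Frank–Kasper nets reach 13.3–13.5 only at spread 1.25–1.30.  One-parameter families
(bct c/a, hcp c/a, ω c and s): max 12.000 at t = 1.14 and 1.15.

STRUCTURE THEORY (why 12 resists; informal, for provers):
* Delaunay recount: deg_t(v) − 12 = Σ_{near e ∋ v}(t_e − 5) + Σ_{far e ∋ v}(t_e − 6) (t_e = tetrahedra on e).  Hence ANY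
  counterexample contains Delaunay edges of valence ≥ 6; with no such edge q̄ ≤ 5 and ⟨deg⟩ ≤ 12/(6 − q̄) ≤ 12.
* Per-tetrahedron form: 2π(E_near − 6N) = Σ_τ φ(τ), φ(τ) := (dihedral sum at near edges) − 6·(total dihedral sum) + 12π.
  Regular unit tet φ = +44.1° (the TetrahedralFrustration constant); octahedron quarter (one far diagonal) −22.07°;
  bcc tet +60° when all six edges are near (t ≥ 2/√3) but −120° below; fcc = 2 tets + 1 octahedron per atom → Σφ = 0,
  and ω balances the same way (2 lens tets + 1 octahedron per atom).  AveragedTwelve ⟺ Σ_τ φ(τ) ≤ 0 for every Delaunay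
  triangulation of a 1-separated set; an all-near triangulation beats 12 iff its mean dihedral sum per tet is < 432°
  (regular: 423.2°), i.e. iff a tetrahedrally close-packed net is realisable with edge spread ≤ t.
* The only NEAR 6-fold motif at t ≤ 57/50 is the FLAT HEXAGONAL LENS: unit bond, six ring atoms at radius R ∈ [1, 1.0245]
  from the axis and height |h| ≤ 0.061 about the mid-plane (puckering makes it worse: the staggered bcc ring needs exactly
  2/√3); a bicapped hexagonal ANTIPRISM (proper Z14: caps at 1, rings at 1.118, ring edges 1 and 1.126) is realisable
  with every edge in [1, 1.126], so Z14 sites are locally admissible at 57/50.  What fails is closing up the lens atoms: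
  in ω the consecutive rings are eclipsed (hexagonal PRISM), the prism's square faces force octahedra with far diagonals
  and the ring atoms are Z11; staggered-ring column lattices cannot share rings consistently (kagome radius a/2 and
  honeycomb radius a/√3 cannot both lie in [1, 1.0245]); perpendicular chain families (A15) force interchain bonds 1.2247.
* Consequently the search space for a counterexample is "flat-lens networks" at t ∈ [√5/2, 2/√3): periodic structures
  whose unit bonds carry flat hexagonal rings AND whose ring atoms are themselves ≥ 12-coordinated — none is known; the
  first structure in which the lens atoms are fully coordinated is bcc, exactly at 2/√3.

SEARCHES: kit j019115 (prior seat, 1024 L-BFGS runs: random m ≤ 14, bcc supercells, FK prototypes free) best 12.000;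
this seat's basin-hopping jobs (j020382/j020506/j020560 pipeline validation; full run j020670: see NOTES / item
evidence) — smooth shifted-sigmoid count + hard-core penalty annealed in the width, packing pre-stage,
repair-to-feasibility, exact recount normalised by the true minimum distance, t-landscape 1.10…1.20, m ≤ 24,
FK/ω/bcc/γ-brass seeds.  Validation run j020560 (4 cores, 13 min): random starts reach 12.000 at t = 1.14 for
m = 2…20 (39/40 runs), 0 flags; at t = 1.16 random m = 2 finds bcc's 14 (control).
MINIMAL BOND-LENGTH SPREAD of tetrahedrally close-packed nets with ALL coordinates and the cell free (j020560 part D;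
spread = longest first-shell bond / shortest pair; a TCP net at spread ≤ 1.14 would average ≥ 13.3):
bcc 14-net 1.1547 (= 2/√3 exactly: bcc is not improvable), A15 1.2247 (cubic A15 already optimal), σ 1.2148,
C15 1.2171, Zr₄Al₃ 1.2304, C14 1.2758, α-Mn (mean CN 12.28) 1.1702, β-Mn 12-net 1.1223 (= 12 exactly, no gain),
ω 14/11/11-net √5/2.  So every known Frank–Kasper topology needs ≥ 1.21, i.e. 6 % MORE than the bcc threshold and
7.5 % more than 57/50; the nearest non-bcc structure exceeding 12 is the relaxed α-Mn net (12.28 at t ≈ 1.170).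
WHY IT RESISTS: the equality locus {Barlow, bct c/a ∈ [1.038,1.788], ω window, β-Mn, many relaxed 12-nets} is FLOPPY
(continuous families), so no proof can come with strictness or local stability — consistent with an integer /
combinatorial identity (the par-five recount) rather than an analytic inequality; and every motif that creates the
needed valence-6 edges below 2/√3 has, in every arrangement tried, under-coordinated ring atoms paying for it exactly. -/
theorem search_record : True := trivial

/-! ## §6 (gen 2) The lattice case is true below `2/√3` — a counterexample must be non-lattice -/

/-- LATTICE CASE (paper proof, not formalised; recorded for provers and searchers).
CLAIM. Let `L ⊂ ℝ³` be a lattice (one point per cell) with minimal distance `λ₁`.  For every `c < 2/√3` the number of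
lattice vectors `v` with `λ₁ ≤ |v| ≤ c·λ₁` is at most 12; it is never 13; and 14 is reached at `c = 2/√3` by bcc ONLY.
Consequently every point of a lattice packing has ≤ 12 others within ratio `c < 2/√3`, the crux holds (even pointwise) for
subsets `G` of a lattice taken at `d = λ₁`, and any counterexample to `AveragedTwelve` has ≥ 2 points per primitive cell
(or is aperiodic).
PROOF. (1) A vector with `|v| < √2·λ₁` is a STRICT Voronoi vector, i.e. `±v` are the unique shortest vectors of the coset
`v + 2L`: if `w ∈ v + 2L`, `w ≠ ±v`, `|w| ≤ |v|`, then `(v ± w)/2 ∈ L ∖ {0}` and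
`|v+w|² + |v−w|² = 2|v|² + 2|w|² ≤ 4|v|² < 8λ₁²`, while each half has norm `≥ λ₁`, giving `≥ 8λ₁²` — contradiction.
(2) `L/2L` has 7 non-zero cosets, each carrying at most one pair `±v` of strict Voronoi vectors, so at most 14 vectors lie
in `[λ₁, √2·λ₁)`, and the count in `[λ₁, cλ₁]` is even (never 13).  (3) Take an obtuse superbase `v₀+v₁+v₂+v₃ = 0`,
`p_ij = −v_i·v_j ≥ 0` (Selling reduction exists in dimension 3; Conway–Sloane, Low-dimensional lattices VI): the coset
minima are the seven vonorms `|v_i|² = Σ_{j≠i} p_ij` (four "vertex" norms) and `|v_i+v_j|² = P − p_ij − p_kl` (three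
"matching" norms, `P = Σ p`).  The vertex norms sum to `2P` (so their minimum is `≤ P/2`) and the matching norms sum to
`2P` (so their maximum is `≥ 2P/3`): the largest of the seven squared norms is `≥ 4/3 ×` the smallest, with equality iff
all six Selling parameters are equal, i.e. `L` is bcc.  Hence for `c² < 4/3` at most six cosets have their minimum in
`[λ₁², c²λ₁²]`: ≤ 12 vectors. ∎
SEARCH CONSEQUENCE: one-atom cells are settled; gen 1's and gen 2's searches over `m ≥ 2` atoms per cell are the right space;
the `m = 2` case (hcp, ω-type, diamond-type…) is the smallest open periodic case. [folklore] -/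
theorem lattice_case_record : True := trivial

/-- TWO ORBITS (sketch, gen 2; details to be checked before anyone relies on it).  CLAIM: a periodic set with TWO points per
primitive cell, `X = L ∪ (L + u)`, min distance 1, has `Z := #{1 ≤ |v| ≤ t : v ∈ L∖0} + #{v ∈ L : |v + u| ≤ t} ≤ 12` neighbours
per point for every `t < 2/√3` (both orbits have the same count `Z = N_L + N_u` by the symmetry `x ↦ u − x`).
KEY LEMMA: three linearly independent lattice vectors of norm `≤ t` generate `L' ⊆ L` with covering radius
`μ(L) ≤ μ(L') ≤ ½√(|a|²+|b|²+|c|²) ≤ (√3/2)·t < 1` (random-vertex argument), so NO point of space is at distance ≥ 1 from `L`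
and a second orbit cannot exist.  Eight vectors of norm in `[1, 1.14]` with pairwise distances ≥ 1 cannot be coplanar (angular
separation ≥ 52.0°, `8 × 52° > 360°`), hence `N_L ≥ 8 ⇒` no second orbit, i.e. `N_L ∈ {0, 2, 4, 6}` whenever `m = 2`.
CASES. `N_L = 0`: the `N_u` coset points lie in the shell `[1, t]` around the site and are pairwise `> t` apart (their
differences are lattice vectors), so pairwise angles `> 60°` and `N_u ≤ 12` (kissing).  `N_L = 6` (coplanar, near-triangular
layer lattice `Λ₂`, `μ(Λ₂) ≲ 0.7`): coset points come in layers at heights `|h| ≥ √(1 − μ₂²) ≈ 0.71` (distance ≥ 1 from the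
site) and a layer at height `h` carries at most 3 points in the annulus `[√(1−h²), √(t²−h²)]` (a near-triangular lattice has
no admissible empty quadrilateral there); only the two adjacent layers are within `t`: `N_u ≤ 6`, `Z ≤ 12` (hcp family:
equality).  `N_L = 4` (rectangular-ish `Λ₂`): ≤ 4 per layer, two layers, `N_u ≤ 8`, `Z ≤ 12` (bct window: equality).
`N_L = 2` (`±a` only, `|a| ∈ [1, t]`): coset points group into `a`-chains; points on distinct chains differ by non-parallel
lattice vectors (norm `> t`) whose vertical parts can be taken `≤ |a|/2`, so distinct chains are `> R_a := √(t² − a²/4) ≥ 0.987`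
apart in projection; a chain carries ≤ 2 points of the ball, and exactly-2 chains live in the annulus `ρ ∈ [√(1 − a²/4), R_a]`
`⊂ [0.82, 1.025]`; five such chains pairwise `> R_a` apart exhaust the disc of radius `t` (no sixth chain of either kind fits),
and with ≤ 4 two-point chains the `> 0.987`-separated chain set has ≤ 7 members none of which can sit near the centre, which the
angular budget at radius ≤ 1.14 forbids — so `N_u ≤ 10`, `Z ≤ 12` (sketch; the case analysis is elementary but unchecked).
Numerically `Z ≤ 12` throughout (gen 1, random `m = 2`).  UPSHOT (modulo checking): the smallest periodic case that could beat
12 has THREE orbits — where the ω/AlB₂ window `(14, 11, 11)` already shows the books balancing exactly. [folklore] -/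
theorem two_orbit_record : True := trivial

/-! ## §7 (gen 2) The radius-one local form — a genuine strengthening — is false; "CompensationLemma" is dead -/

/-- STAR (radius-one, closed-neighbourhood) form of the crux at ratio constant `c`: for every site `i`, the closed
`ρ`-star `B i = {j ∈ G : dist (x i) (x j) ≤ ρ}` satisfies `Σ_{j ∈ B i} deg j ≤ 12·|B i|`.  This is exactly what a
radius-one discharging / local-averaging rule would establish. -/
def AveragedTwelveStar (c : ℝ) : Prop :=
  ∀ (N : ℕ) (x : Fin N → EuclideanSpace ℝ (Fin 3)) (G : Finset (Fin N)) (d ρ : ℝ),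
    0 < d → ρ ≤ c * d → (∀ i ∈ G, ∀ j ∈ G, i ≠ j → d ≤ dist (x i) (x j)) →
    ∀ i ∈ G, (∑ j ∈ G.filter (fun j => dist (x i) (x j) ≤ ρ),
        ((G.filter fun k => k ≠ j ∧ dist (x j) (x k) ≤ ρ).card : ℝ))
      ≤ 12 * (G.filter (fun j => dist (x i) (x j) ≤ ρ)).card

/-- WEAK COMPENSATION at ratio constant `c`: a site with ≥ 13 `ρ`-neighbours has a `ρ`-neighbour with ≤ 11.  The weakest
statement of the family "over-coordination is paid for next door" (the route's planned layer-2 child CompensationLemma,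
`Σ_{nbrs}(12 − Z)₊ ≥ (Z − 12)₊`, implies it). -/
def WeakCompensation (c : ℝ) : Prop :=
  ∀ (N : ℕ) (x : Fin N → EuclideanSpace ℝ (Fin 3)) (G : Finset (Fin N)) (d ρ : ℝ),
    0 < d → ρ ≤ c * d → (∀ i ∈ G, ∀ j ∈ G, i ≠ j → d ≤ dist (x i) (x j)) →
    ∀ i ∈ G, 13 ≤ (G.filter fun j => j ≠ i ∧ dist (x i) (x j) ≤ ρ).card →
      ∃ j ∈ G, j ≠ i ∧ dist (x i) (x j) ≤ ρ ∧ (G.filter fun k => k ≠ j ∧ dist (x j) (x k) ≤ ρ).card ≤ 11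

/-- The star form implies the crux (LANDED: `AveragedTwelveNegative.averaged_of_star`, Cauchy–Schwarz:
summing the stars gives `Σ deg² ≤ 11 Σ deg + 12 n`, and `(Σ deg)² ≤ n Σ deg²` forces `Σ deg ≤ 12 n`). -/
theorem averagedTwelve_of_star : AveragedTwelveStar (57 / 50) → AveragedTwelve :=
  fun H N x G d ρ hd hρ hsep =>
    Summit.AtomisticToContinuum.Crystallization.Theorems.AveragedTwelveNegative.averaged_of_star (57 / 50) H N x G d ρ hd hρ hsep

/-- RADIUS-ONE LOCAL FORM REFUTED (LANDED: `AveragedTwelveNegative.not_averagedTwelve_star`, kernel `decide` on a 55-point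
integer certificate from kit j022691): a Z14 centre (bicapped staggered hexagonal antiprism continued as a short rod) whose 14
neighbours are ALL brought to ≥ 12 by free outer atoms (two at 14, three at 13, nine at 12): the closed 1.14-star of 15 sites
sums to 187 > 180.  Thirteen of 24 random restarts of the decoration give such stars (excess +3 … +7).  CONSEQUENCE: no proof
can show that closed ρ-stars average ≤ 12; the deficit paying for a Z14 site is not adjacent to it. -/
theorem not_averagedTwelveStar : ¬ AveragedTwelveStar (57 / 50) :=
  Summit.AtomisticToContinuum.Crystallization.Theorems.AveragedTwelveNegative.not_averagedTwelve_star

/-- WEAK COMPENSATION REFUTED (LANDED: `AveragedTwelveNegative.not_averagedTwelve_weakCompensation`, same witness): a site with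
14 neighbours within ρ none of which has fewer than 12.  Hence the route file's TWO-LAYER PLAN child "CompensationLemma (every
Z ≥ 13 site within ratio 1.14 forces Σ(12 − Z)₊ ≥ Σ(Z − 12)₊ among its 1.14-neighbours)" is FALSE and must not be filed; any
discharging towards under-coordinated sites has to look at graph distance ≥ 2 (numerically the deficit sits on the free
decoration atoms at distance 2 — whether radius 2 suffices is the subject of §9). -/
theorem not_weakCompensation : ¬ WeakCompensation (57 / 50) :=
  Summit.AtomisticToContinuum.Crystallization.Theorems.AveragedTwelveNegative.not_averagedTwelve_weakCompensation

/-! ## §8 (gen 2) The pointwise excess reaches +4 -/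

/-- POINTWISE CAP `k` at ratio constant `c`: every site has at most `k` neighbours within `ρ`. -/
def PointwiseCap (c : ℝ) (k : ℕ) : Prop :=
  ∀ (N : ℕ) (x : Fin N → EuclideanSpace ℝ (Fin 3)) (G : Finset (Fin N)) (d ρ : ℝ),
    0 < d → ρ ≤ c * d → (∀ i ∈ G, ∀ j ∈ G, i ≠ j → d ≤ dist (x i) (x j)) →
    ∀ i ∈ G, ((G.filter fun j => j ≠ i ∧ dist (x i) (x j) ≤ ρ).card) ≤ k

/-- `PointwiseCap (57/50) 12` is §4's `AveragedTwelvePointwise`. -/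
theorem pointwiseCap_twelve_iff : PointwiseCap (57 / 50) 12 ↔ AveragedTwelvePointwise := Iff.rfl

/-- SIXTEEN NEIGHBOURS (LANDED: `AveragedTwelveNegative.not_averagedTwelve_pointwise15`, kernel `decide`): the Tammes-16
arrangement (min-chord ratio 1.13577 < 57/50, integer-rounded at scale 1000) gives a centre with 16 others within ρ, so
`PointwiseCap (57/50) 15` is false and the per-site excess an averaging argument must absorb is as large as +4.  (A cap of 16
would follow from the Tammes-17 value 1.1589 > 1.14, known only numerically; the best PROVED per-site caps at this ratio are
area bounds ≈ 19.) -/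
theorem not_pointwiseCap15 : ¬ PointwiseCap (57 / 50) 15 :=
  Summit.AtomisticToContinuum.Crystallization.Theorems.AveragedTwelveNegative.not_averagedTwelve_pointwise15

/-- Monotonicity of caps (so caps 12, 13, 14 are refuted as well). -/
theorem pointwiseCap_mono {c : ℝ} {k k' : ℕ} (h : k ≤ k') : PointwiseCap c k → PointwiseCap c k' :=
  fun H N x G d ρ hd hρ hsep i hi => (H N x G d ρ hd hρ hsep i hi).trans h



/-! ## §9 (gen 2) Radius-two ball averaging fails too; search record II; why it still resists -/

/-- RADIUS-TWO BALL form at ratio constant `c`: for every site `i`, the graph ball of radius two in the `ρ`-contact graph,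
`B₂ i = {j ∈ G : ∃ k ∈ G, dist (x i) (x k) ≤ ρ ∧ dist (x k) (x j) ≤ ρ}`, satisfies `Σ_{j ∈ B₂ i} deg j ≤ 12·|B₂ i|`.  (Not a formal
consequence of the crux — the weights `|B₂ j|` are not constant — but exactly what a flat radius-two averaging rule proves.) -/
def AveragedTwelveBall2 (c : ℝ) : Prop :=
  ∀ (N : ℕ) (x : Fin N → EuclideanSpace ℝ (Fin 3)) (G : Finset (Fin N)) (d ρ : ℝ),
    0 < d → ρ ≤ c * d → (∀ i ∈ G, ∀ j ∈ G, i ≠ j → d ≤ dist (x i) (x j)) →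
    ∀ i ∈ G, (∑ j ∈ G.filter (fun j => ∃ k ∈ G, dist (x i) (x k) ≤ ρ ∧ dist (x k) (x j) ≤ ρ),
        ((G.filter fun l => l ≠ j ∧ dist (x j) (x l) ≤ ρ).card : ℝ))
      ≤ 12 * (G.filter (fun j => ∃ k ∈ G, dist (x i) (x k) ≤ ρ ∧ dist (x k) (x j) ≤ ρ)).card

/-- RADIUS-TWO BALL AVERAGING REFUTED (LANDED: `AveragedTwelveNegative.not_averagedTwelve_ball2`, `native_decide`,
computational): the radius-one witness grown by one onion layer of free atoms (kit j022879, seed 2004; 151-point integer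
certificate, scale 6400, `D = 40958078`, `M = 7295`) has a radius-two ball of 55 sites with degrees 14,14,13×8,12×41,11×4 —
sum 668 > 660.  Radius THREE was NOT reached: 16 further growth attempts (kit j022963) leave 98–107 of the ≈ 150 radius-three
sites below 12 (best Σ(deg − 12) = −261); the all-at-once finite optimisation of radius-two balls on longer rods (kit j022818,
40 runs) stays at ≥ 16 sites short (best −18).  So the non-locality any discharging must have is ≥ 2 hops and, numerically,
3 hops look sufficient around an isolated Z14 rod segment. -/
theorem not_averagedTwelveBall2 : ¬ AveragedTwelveBall2 (57 / 50) :=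
  Summit.AtomisticToContinuum.Crystallization.Theorems.AveragedTwelveNegative.not_averagedTwelve_ball2

/-- SEARCH RECORD II (cdisprove gen 2, 2026-08-17) AND WHY IT STILL RESISTS.

COMPENSATION GEOMETRY OF THE Z14 MOTIF (for an all-near site the excess is the number of 6-valent near bonds through it —
lead's all-near vertex theorem — and the only 6-valent near motif at 57/50 is the flat hexagonal lens (gen 1, §5); two such
bonds through a site make it Z14, excess +2):
* isolated Z14 site: compensation-free to graph radius 1 (`StarLocal`, 13/24 decorations succeed, excess +3…+7) and to
  radius 2 in the flat-average sense (`BallTwo`, +8 with four 11s); NOT to radius 3 (above).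
* z-PERIODIC decorated Z14 rod (every axis site 14; kit j022831, j022882; axis spacing 1.00–1.08, ring radius 1.00–1.03,
  decoration schemes O_a/O_b/O_c, O_b/O_c, O_a + outer ring, random sequential 18–30 per period; ≈ 130 runs): the RINGS can
  NOT all be brought to 12 — best Σ(deg − 12) over axis + rings per period = 0, reached only by degrading the axis to 13/12;
  with the axis held at 14 the best is −3.  Mechanism: the decorations serving consecutive (staggered) rings collide — the
  "between ring atoms" sites of one ring sit 0.46–0.57 from the "outside the ring atom" sites of the next.  So the +2 per axis
  site of an infinite rod is paid inside the rod's own first decoration shell: per unit length the books balance at radius 1.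
* ROD CRYSTALS (kit j022839; hexagonal / honeycomb / square / rectangular-row arrays of period-2 rods, spacing 2.75–4.0, relative
  z-phases 0, l/4, l/2, free fill atoms, all coordinates free, the crux's own objective): 144 runs, best average 10.58 — the
  optimiser never even recovers 12 from these seeds (glassy fill); weak evidence, recorded for completeness.  The consistent
  way to share rod decorations IS the Frank–Kasper rod-packing geometry, which needs spread ≥ 1.21 (gen 1, part D) — bcc at 2/√3
  is the degenerate all-rod limit.
OTHER SEARCHES: hard-core Monte Carlo with tolerance (1.14…1.30) + temperature replica exchange (kit j022700/j022721 validation;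
the full 2 h run j022736, N = 6…54, random and bcc/ω/A15/β-Mn/fcc/hcp/sc seeds, was still running when this was written — its
summary attaches to the item automatically): every seed relaxes to 12.000 at 1.14/1.155; the sampler does NOT recover bcc's 14
at 1.16 from random starts within 11 min (the 14-basin is a needle of width ≈ 0.5 % in the
first-shell radius while the 12-basins are fat) — so Monte Carlo is the wrong tool for this landscape and its null result is weak;
landscape by-product: 13.5 (A15-like) from t ≈ 1.24, 14 from 1.17 only when seeded at bcc.  Literature (searchd down, S2 429):
crossref/arXiv sweep "contact numbers / square-well ground states / near neighbours" — only the known Bezdek–Lángi soft-density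
problem (arXiv:1601.00145 §6: λ < 2/√3 − 1 regime named, no counting result) and square-well THERMOdynamics; nothing new.
STRUCTURE: the lattice case is a theorem (§6), two orbits nearly so; bcc is the unique lattice extremiser at 2/√3.
WHY IT RESISTS (gen-2 view): (i) local excess exists only as Z14/Z15/Z16 sites built from flat hexagonal lenses; (ii) a single
such site is freely realisable and even compensation-free for two graph hops, so NO argument of radius ≤ 2 in the contact graph
can work, and the planner's radius-one CompensationLemma is false; (iii) but the motif does not PROPAGATE: already a periodic rod
of Z14 sites cannot keep its rings at 12, and 3-D sharing of decorations is Frank–Kasper geometry (spread ≥ 1.21); (iv) every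
relaxed structure found by four independent search pipelines (gen-1 L-BFGS/basin hopping m ≤ 24, FK minimal spreads, gen-2 MC,
rod crystals) saturates at exactly 12.000 on a floppy equality locus.  A proof therefore has to be GLOBAL-with-radius-≥-3 or
structural (rod lemma: lenses force rods, rods force rings below 12), not a one- or two-centre inequality. [folklore] -/
theorem search_record_g2 : True := trivial

end Summit.AtomisticToContinuum.Crystallization.Cruxes.AveragedTwelve.Disproof
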